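import Literature.Analysis.PDE.PoissonBall
import Mathlib.Analysis.SpecialFunctions.Pow.Asymptotics
import Mathlib.Analysis.InnerProductSpace.Harmonic.Basic
import HarnessLib

/-!
# Removable isolated singularities of bounded harmonic functions (`dim ≥ 3`)

Analysis support file (everything proved; no definitions, no named facts).

**Theorem (classical; removable singularity theorem for harmonic functions, `n ≥ 3`).** Let `E`
be a real inner product space of finite dimension `n ≥ 3`, `p ∈ E`, `R > 0`, and let `g : E → ℝ`
be harmonic (Mathlib's `InnerProductSpace.HarmonicAt`) at every point of the punctured ball
`B(p, R) ∖ {p}` and bounded there. Then `g` agrees off `p` with a function harmonic on `B(p, R)`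
(`exists_harmonicOnNhd_eq_of_bounded`); if `g` is continuous at `p` it is itself harmonic at `p`
(`harmonicAt_of_harmonic_punctured_of_continuousAt`); and finitely many bounded isolated
singularities of a function harmonic elsewhere are removable at once
(`exists_harmonicOnNhd_univ_eq_of_finset`). (Axler–Bourdon–Ramey, *Harmonic Function Theory*,
Thm. 2.3; Gilbarg–Trudinger, Ch. 2–3.)

Proof (maximum principle with the Newtonian comparison function). Let `h = P[g]` be the Poisson
solution on `B(p, R/2)` with the boundary values of `g` (`Literature.Analysis.PDE.PoissonBall`).
`u = g - h` is harmonic and bounded on the punctured ball and `0` on the sphere; for `ε > 0`,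
`u - ε(Φ - Φ(R/2))` with `Φ(w) = (‖w - p‖²)^{-(n-2)/2}` (harmonic off `p`, `→ +∞` at `p` since
`n ≥ 3`) is `≤ 0` on the outer sphere and on all small inner spheres, hence on the annuli between
them (`PoissonBall.le_of_frontier_le`); `ε → 0` gives `u ≤ 0`, symmetrically `u ≥ 0`
(`nonpos_of_harmonic_punctured_ball`), so `g = h` off `p`.

Mathlib / tree search: Mathlib has `InnerProductSpace.HarmonicAt/HarmonicOnNhd`; the tree has the
planar case only (`Literature.Analysis.Complex.exists_harmonicOnNhd_ball_eqOn_of_bounded`,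
complex-analytic proof); `lean search 'removable.*[Hh]armonic|isolated.*singular.*harmonic'`:
nothing in dimension `≥ 3`. Tree (used): `PoissonBall.{poisson, contDiffAt_poisson,
laplacian_poisson_eq_zero, continuousOn_poisson, poisson_eq_self_of_mem_sphere, abs_poisson_le,
le_of_frontier_le, hasDerivAt_rpow_neg}`, `FluidPDE.laplacian_comp_norm_sq`,
`PDE.LoewnerNirenberg.laplacian_translate_sub`.

## References

* S. Axler, P. Bourdon, W. Ramey, *Harmonic Function Theory*, 2nd ed. (Springer GTM 137, 2001),
  Thm. 2.3 (isolated singularities of bounded harmonic functions are removable).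
* D. Gilbarg, N. S. Trudinger, *Elliptic Partial Differential Equations of Second Order* (2001),
  Thm. 2.6 (Poisson integral), Thm. 3.1 (weak maximum principle). [GilbargTrudinger2001]
-/
noncomputable section

open Set Filter Metric Module InnerProductSpace Function
open _root_.Topology
open scoped Laplacian RealInnerProductSpace

namespace Literature.Analysis.FluidPDE

variable {E : Type*} [NormedAddCommGroup E] [InnerProductSpace ℝ E]

/-! ### The comparison function `Φ(w) = (‖w - p‖²)^{-(n-2)/2}` -/

/-- **The Newtonian comparison function is harmonic off its pole**: for `n = dim E`, the radial
function `w ↦ (‖w - p‖²)^{-(n-2)/2}` has vanishing Laplacian at every `w ≠ p`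
(`Δ g(‖z‖²) = 4g''‖z‖² + 2n g'` with `g(σ) = σ^{-q}`, `q = (n-2)/2`: `4q(q+1) - 2nq = 0`).
[folklore] -/
theorem laplacian_norm_sub_sq_rpow_eq_zero [FiniteDimensional ℝ E] (p : E) {x : E} (hx : x ≠ p) :
    (Δ (fun w : E => (‖w - p‖ ^ 2) ^ (-(((finrank ℝ E : ℝ) - 2) / 2)))) x = 0 := by
  set q : ℝ := ((finrank ℝ E : ℝ) - 2) / 2 with hq
  set z : E := x - p with hz
  have hz0 : z ≠ 0 := sub_ne_zero.2 hx
  have hs : 0 < ‖z‖ ^ 2 := by positivity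
  set G : ℝ → ℝ := fun τ => τ ^ (-q) with hG
  have hGd : ∀ σ ∈ Ioi (0 : ℝ), HasDerivAt G (-q * σ ^ (-q - 1)) σ := fun σ hσ =>
    PDE.PoissonBall.hasDerivAt_rpow_neg q hσ
  have hG₁ : HasDerivAt (fun σ : ℝ => -q * σ ^ (-q - 1))
      (-q * ((-q - 1) * (‖z‖ ^ 2) ^ (-q - 1 - 1))) (‖z‖ ^ 2) :=
    (Real.hasDerivAt_rpow_const (Or.inl hs.ne')).const_mul (-q)
  rw [PDE.LoewnerNirenberg.laplacian_translate_sub (fun w : E => (‖w‖ ^ 2) ^ (-q)) p x]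
  have key := laplacian_comp_norm_sq (E := E) (g := G) isOpen_Ioi hGd (z := z) hs hG₁
  simp only [hG] at key
  rw [← hz, key]
  have e1 : (‖z‖ ^ 2) ^ (-q - 1 - 1) * ‖z‖ ^ 2 = (‖z‖ ^ 2) ^ (-q - 1) := by
    rw [Real.rpow_sub_one hs.ne']
    field_simp
  have hn : (finrank ℝ E : ℝ) = 2 * q + 2 := by rw [hq]; ring
  rw [hn]
  calc 4 * (-q * ((-q - 1) * (‖z‖ ^ 2) ^ (-q - 1 - 1))) * ‖z‖ ^ 2 +
        2 * (2 * q + 2) * (-q * (‖z‖ ^ 2) ^ (-q - 1))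
      = 4 * q * (q + 1) * ((‖z‖ ^ 2) ^ (-q - 1 - 1) * ‖z‖ ^ 2) -
          4 * q * (q + 1) * (‖z‖ ^ 2) ^ (-q - 1) := by ring
    _ = 0 := by rw [e1]; ring

/-- The comparison function `w ↦ (‖w - p‖²)^{-(n-2)/2}` is harmonic at every `x ≠ p`. [folklore] -/
theorem harmonicAt_norm_sub_sq_rpow [FiniteDimensional ℝ E] (p : E) {x : E} (hx : x ≠ p) :
    HarmonicAt (fun w : E => (‖w - p‖ ^ 2) ^ (-(((finrank ℝ E : ℝ) - 2) / 2))) x := by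
  refine ⟨?_, ?_⟩
  · have h1 : ContDiffAt ℝ 2 (fun w : E => ‖w - p‖ ^ 2) x :=
      ((contDiff_norm_sq ℝ).comp (contDiff_id.sub contDiff_const)).contDiffAt
    exact h1.rpow_const_of_ne (by have := sub_ne_zero.2 hx; positivity)
  · filter_upwards [isOpen_ne.mem_nhds hx] with w hw
    exact laplacian_norm_sub_sq_rpow_eq_zero p hw

/-- The comparison function blows up at its pole when `n ≥ 3`: `(ρ²)^{-(n-2)/2} → +∞` as
`ρ → 0⁺`. [folklore] -/
theorem tendsto_sq_rpow_atTop [FiniteDimensional ℝ E] (hn : 3 ≤ finrank ℝ E) :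
    Tendsto (fun ρ : ℝ => (ρ ^ 2) ^ (-(((finrank ℝ E : ℝ) - 2) / 2))) (𝓝[>] 0) atTop := by
  set q : ℝ := ((finrank ℝ E : ℝ) - 2) / 2 with hq
  have hq0 : 0 < q := by
    have : (3 : ℝ) ≤ finrank ℝ E := by exact_mod_cast hn
    rw [hq]; linarith
  have h1 : Tendsto (fun ρ : ℝ => ρ ^ 2) (𝓝[>] (0 : ℝ)) (𝓝[>] 0) := by
    refine tendsto_nhdsWithin_iff.2 ⟨?_, ?_⟩
    · simpa using ((continuous_pow 2).tendsto (0 : ℝ)).mono_left nhdsWithin_le_nhds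
    · filter_upwards [self_mem_nhdsWithin] with ρ (hρ : 0 < ρ) using pow_pos hρ 2
  refine (((tendsto_rpow_atTop hq0).comp tendsto_inv_nhdsGT_zero).comp h1).congr' ?_
  filter_upwards [self_mem_nhdsWithin] with ρ (hρ : 0 < ρ)
  simp only [Function.comp_apply]
  rw [Real.inv_rpow (sq_nonneg ρ), Real.rpow_neg (sq_nonneg ρ)]

/-! ### Maximum principle with a bounded isolated singularity -/

/-- **A bounded isolated singularity does not spoil the maximum principle (`n ≥ 3`).** If `u` is
continuous on `B̄(p, r) ∖ {p}`, harmonic on `B(p, r) ∖ {p}`, bounded above there, and `u ≤ 0` on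
the sphere `‖w - p‖ = r`, then `u ≤ 0` on the punctured ball: compare with
`ε((‖w - p‖²)^{-(n-2)/2} - (r²)^{-(n-2)/2})` on annuli `ρ < ‖w - p‖ < r` (weak maximum principle)
and let `ρ → 0`, then `ε → 0`. [folklore] -/
theorem nonpos_of_harmonic_punctured_ball [FiniteDimensional ℝ E] (hn : 3 ≤ finrank ℝ E)
    {u : E → ℝ} {p : E} {r M : ℝ} (huc : ContinuousOn u (closedBall p r \ {p}))
    (hu : ∀ x ∈ ball p r, x ≠ p → HarmonicAt u x) (hM : ∀ x ∈ ball p r, x ≠ p → u x ≤ M)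
    (h0 : ∀ x ∈ sphere p r, u x ≤ 0) : ∀ x ∈ ball p r, x ≠ p → u x ≤ 0 := by
  intro x hx hxp
  have hn0 : 0 < finrank ℝ E := by omega
  set q : ℝ := ((finrank ℝ E : ℝ) - 2) / 2 with hq
  set Φ : E → ℝ := fun w => (‖w - p‖ ^ 2) ^ (-q) with hΦ
  have hΦpos : ∀ w, w ≠ p → 0 < Φ w := fun w hw => by
    have : 0 < ‖w - p‖ ^ 2 := by have := sub_ne_zero.2 hw; positivity
    exact Real.rpow_pos_of_pos this _
  have hΦsph : ∀ {s : ℝ} {w : E}, w ∈ sphere p s → Φ w = (s ^ 2) ^ (-q) := by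
    intro s w hw
    rw [mem_sphere, dist_eq_norm] at hw
    simp only [hΦ, hw]
  have hdx : 0 < dist x p := dist_pos.2 hxp
  have hxr : dist x p < r := mem_ball.1 hx
  -- it suffices to prove `u x ≤ ε Φ x` for every `ε > 0`
  suffices key : ∀ ε : ℝ, 0 < ε → u x ≤ ε * Φ x by
    refine le_of_forall_pos_le_add fun δ hδ => ?_
    have h := key (δ / Φ x) (div_pos hδ (hΦpos x hxp))
    rw [div_mul_cancel₀ _ (hΦpos x hxp).ne'] at h
    linarith
  intro ε hε
  -- choose the inner radius
  have hev : ∀ᶠ ρ in 𝓝[>] (0 : ℝ), ρ < dist x p ∧ M + ε * (r ^ 2) ^ (-q) ≤ ε * (ρ ^ 2) ^ (-q) := by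
    refine (eventually_of_mem (Ioo_mem_nhdsGT hdx) fun ρ hρ => hρ.2).and ?_
    have ht := (tendsto_sq_rpow_atTop (E := E) hn).const_mul_atTop hε
    exact ht.eventually_ge_atTop _
  obtain ⟨ρ, ⟨hρx, hρ⟩, hρ0⟩ := (hev.and self_mem_nhdsWithin).exists
  change 0 < ρ at hρ0
  -- the annulus
  set D : Set E := ball p r \ closedBall p ρ with hD
  have hDo : IsOpen D := isOpen_ball.sdiff isClosed_closedBall
  have hDb : Bornology.IsBounded D := isBounded_ball.subset Set.sdiff_subset
  have hDcl : closure D ⊆ closedBall p r \ ball p ρ := by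
    refine (closure_minimal ?_ (isClosed_closedBall.sdiff isOpen_ball))
    intro w hw
    exact ⟨ball_subset_closedBall hw.1, fun h => hw.2 (ball_subset_closedBall h)⟩
  have hclne : ∀ w ∈ closure D, w ≠ p := fun w hw h => by
    have := (hDcl hw).2
    rw [h] at this
    exact this (mem_ball_self hρ0)
  set v : E → ℝ := fun w => u w - ε * (Φ w - (r ^ 2) ^ (-q)) with hv
  -- continuity on the closure
  have hΦc : ∀ w, w ≠ p → ContinuousAt Φ w := fun w hw =>
    (harmonicAt_norm_sub_sq_rpow p hw).1.continuousAt
  have hvc : ContinuousOn v (closure D) := by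
    intro w hw
    have hw' := hDcl hw
    have h1 : ContinuousWithinAt u (closure D) w :=
      (huc w ⟨hw'.1, hclne w hw⟩).mono (fun w' hw' => ⟨(hDcl hw').1, hclne w' hw'⟩)
    exact h1.sub ((continuousWithinAt_const.mul
      (((hΦc w (hclne w hw)).continuousWithinAt).sub continuousWithinAt_const)))
  -- harmonicity inside
  have hvh : ∀ w ∈ D, HarmonicAt v w := by
    intro w hw
    have hwp : w ≠ p := hclne w (subset_closure hw)
    have h1 : HarmonicAt (fun w => ε * (Φ w - (r ^ 2) ^ (-q))) w := by
      have h2 : HarmonicAt (fun w => Φ w - (r ^ 2) ^ (-q)) w :=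
        (harmonicAt_norm_sub_sq_rpow p hwp).sub (harmonicAt_const ((r ^ 2) ^ (-q)))
      have := h2.const_smul (c := ε)
      simpa only [Pi.smul_def, smul_eq_mul] using this
    exact (hu w hw.1 hwp).sub h1
  have hv2 : ∀ w ∈ D, ContDiffAt ℝ 2 v w := fun w hw => (hvh w hw).1
  have hvΔ : ∀ w ∈ D, 0 ≤ (Δ v) w := fun w hw => (hvh w hw).2.eq_of_nhds.symm.le
  -- boundary values
  have hfr : ∀ w ∈ frontier D, v w ≤ 0 := by
    intro w hw
    rw [hDo.frontier_eq] at hw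
    have hwcl := hDcl hw.1
    have hwp : w ≠ p := hclne w hw.1
    by_cases hwr : w ∈ ball p r
    · -- then `w ∈ closedBall p ρ`, so `dist w p = ρ`
      have hwρ : w ∈ sphere p ρ := by
        have h1 : w ∈ closedBall p ρ := by
          by_contra h; exact hw.2 ⟨hwr, h⟩
        have h2 := hwcl.2
        rw [mem_ball, not_lt] at h2
        exact mem_sphere.2 (le_antisymm (mem_closedBall.1 h1) h2)
      have hub : u w ≤ M := hM w hwr hwp
      simp only [hv, hΦsph hwρ]
      linarith
    · have hws : w ∈ sphere p r := by
        rw [mem_ball, not_lt] at hwr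
        exact mem_sphere.2 (le_antisymm (mem_closedBall.1 hwcl.1) hwr)
      simp only [hv, hΦsph hws, sub_self, mul_zero, sub_zero]
      exact h0 w hws
  -- the weak maximum principle on the annulus
  have hxD : x ∈ D := ⟨hx, fun h => by
    have := mem_closedBall.1 h; linarith⟩
  have hmax := PDE.PoissonBall.le_of_frontier_le hn0 hDo hDb hvc hv2 hvΔ hfr x (subset_closure hxD)
  simp only [hv] at hmax
  have hr0 : 0 ≤ ε * (r ^ 2) ^ (-q) := mul_nonneg hε.le (Real.rpow_nonneg (sq_nonneg r) _)
  linarith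

/-! ### Removable singularities -/

/-- **Removable isolated singularities of bounded harmonic functions (`n ≥ 3`).** If `g` is
harmonic at every point of the punctured ball `B(p, R) ∖ {p}` of a real inner product space of
dimension `n ≥ 3` and bounded there, then it agrees off `p` with a function `G` harmonic on the
whole ball `B(p, R)`; namely `G = g` off `p` and `G p = P[g](p)` for the Poisson solution `P[g]` on
`B(p, R/2)`, which coincides with `g` on the punctured half-ball by the maximum principle with a
bounded isolated singularity (Axler–Bourdon–Ramey, Thm. 2.3). [folklore] -/
theorem exists_harmonicOnNhd_eq_of_bounded [FiniteDimensional ℝ E] [MeasurableSpace E]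
    [BorelSpace E] (hn : 3 ≤ finrank ℝ E) {g : E → ℝ} {p : E} {R M : ℝ} (hR : 0 < R)
    (hg : ∀ x ∈ ball p R, x ≠ p → HarmonicAt g x) (hM : ∀ x ∈ ball p R, x ≠ p → |g x| ≤ M) :
    ∃ G : E → ℝ, HarmonicOnNhd G (ball p R) ∧ ∀ x, x ≠ p → G x = g x := by
  classical
  have hn0 : 0 < finrank ℝ E := by omega
  set r : ℝ := R / 2 with hr
  have hr0 : 0 < r := by positivity
  have hrR : r < R := by rw [hr]; linarith
  have hcb : closedBall p r ⊆ ball p R := closedBall_subset_ball hrR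
  have hbb : ball p r ⊆ ball p R := ball_subset_ball hrR.le
  -- `g` is continuous off `p` in the big ball
  have hgc : ∀ x ∈ ball p R, x ≠ p → ContinuousAt g x := fun x hx hxp =>
    (hg x hx hxp).1.continuousAt
  have hsph : ∀ x ∈ sphere p r, x ∈ ball p R ∧ x ≠ p := fun x hx =>
    ⟨hcb (sphere_subset_closedBall hx), by rintro rfl; simp [hr0.ne] at hx⟩
  have hψ : ContinuousOn g (sphere p r) := fun x hx =>
    (hgc x (hsph x hx).1 (hsph x hx).2).continuousWithinAt
  set h : E → ℝ := PDE.PoissonBall.poisson p r g with hh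
  have hh2 : ∀ x ∈ ball p r, ContDiffAt ℝ 2 h x := fun x hx =>
    PDE.PoissonBall.contDiffAt_poisson hr0 hψ hx
  have hhΔ : ∀ x ∈ ball p r, (Δ h) x = 0 := fun x hx =>
    PDE.PoissonBall.laplacian_poisson_eq_zero hr0 hψ hx
  have hhc : ContinuousOn h (closedBall p r) := PDE.PoissonBall.continuousOn_poisson hn0 hr0 hψ
  have hhs : ∀ x ∈ sphere p r, h x = g x := fun x hx =>
    PDE.PoissonBall.poisson_eq_self_of_mem_sphere g hx
  have hhh : ∀ x ∈ ball p r, HarmonicAt h x := fun x hx =>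
    ⟨hh2 x hx, Filter.eventually_of_mem (isOpen_ball.mem_nhds hx) fun y hy => hhΔ y hy⟩
  -- `|g| ≤ M` on the sphere, hence `|h| ≤ M` on the closed ball
  have hMs : ∀ ζ ∈ sphere p r, |g ζ| ≤ M := fun ζ hζ => hM ζ (hsph ζ hζ).1 (hsph ζ hζ).2
  have hhM : ∀ x ∈ closedBall p r, |h x| ≤ M := fun x hx =>
    PDE.PoissonBall.abs_poisson_le hn0 hr0 hψ hMs hx
  have hgc' : ContinuousOn g (closedBall p r \ {p}) := fun x hx =>
    (hgc x (hcb hx.1) hx.2).continuousWithinAt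
  -- `g = h` on the punctured ball (maximum principle with a bounded isolated singularity, twice)
  have heq : ∀ x ∈ ball p r, x ≠ p → g x = h x := by
    intro x hx hxp
    have h1 := nonpos_of_harmonic_punctured_ball hn (u := fun w => g w - h w) (M := M + M)
      (hgc'.sub (hhc.mono Set.sdiff_subset))
      (fun w hw hwp => (hg w (hbb hw) hwp).sub (hhh w hw))
      (fun w hw hwp => by
        have a := (abs_le.1 (hM w (hbb hw) hwp)).2
        have b := (abs_le.1 (hhM w (ball_subset_closedBall hw))).1
        show g w - h w ≤ M + M
        linarith)
      (fun w hw => by show g w - h w ≤ 0; rw [hhs w hw, sub_self]) x hx hxp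
    have h2 := nonpos_of_harmonic_punctured_ball hn (u := fun w => h w - g w) (M := M + M)
      ((hhc.mono Set.sdiff_subset).sub hgc')
      (fun w hw hwp => (hhh w hw).sub (hg w (hbb hw) hwp))
      (fun w hw hwp => by
        have a := (abs_le.1 (hM w (hbb hw) hwp)).1
        have b := (abs_le.1 (hhM w (ball_subset_closedBall hw))).2
        show h w - g w ≤ M + M
        linarith)
      (fun w hw => by show h w - g w ≤ 0; rw [hhs w hw, sub_self]) x hx hxp
    exact le_antisymm (by linarith [h1]) (by linarith [h2])
  -- the extension
  refine ⟨Function.update g p (h p), fun x hx => ?_, fun x hx => Function.update_of_ne hx _ _⟩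
  by_cases hxr : x ∈ ball p r
  · have hev : Function.update g p (h p) =ᶠ[𝓝 x] h := by
      filter_upwards [isOpen_ball.mem_nhds hxr] with w hw
      by_cases hwp : w = p
      · rw [hwp, Function.update_self]
      · rw [Function.update_of_ne hwp]; exact heq w hw hwp
    exact (harmonicAt_congr_nhds hev).2 (hhh x hxr)
  · have hxp : x ≠ p := fun h' => hxr (h' ▸ mem_ball_self hr0)
    have hev : Function.update g p (h p) =ᶠ[𝓝 x] g := by
      filter_upwards [compl_singleton_mem_nhds hxp] with w hw
      exact Function.update_of_ne hw _ _
    exact (harmonicAt_congr_nhds hev).2 (hg x hx hxp)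

/-- **Removable isolated singularities, continuous version (`n ≥ 3`).** A function which is
harmonic on a punctured ball `B(p, R) ∖ {p}` of a real inner product space of dimension `n ≥ 3`
and continuous at `p` is harmonic at `p` (it is bounded near `p`, so it has a harmonic extension
across `p` by `exists_harmonicOnNhd_eq_of_bounded`, whose value at `p` is the limit of `g`,
i.e. `g p`). [folklore] -/
theorem harmonicAt_of_harmonic_punctured_of_continuousAt [FiniteDimensional ℝ E]
    [MeasurableSpace E] [BorelSpace E] (hn : 3 ≤ finrank ℝ E) {g : E → ℝ} {p : E} {R : ℝ}
    (hR : 0 < R) (hg : ∀ x ∈ ball p R, x ≠ p → HarmonicAt g x) (hc : ContinuousAt g p) :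
    HarmonicAt g p := by
  classical
  -- `g` is bounded near `p`
  obtain ⟨δ, hδ, hδb⟩ : ∃ δ > 0, ∀ x ∈ ball p δ, |g x - g p| < 1 := by
    obtain ⟨δ, hδ, h⟩ := Metric.continuousAt_iff.1 hc 1 one_pos
    exact ⟨δ, hδ, fun x hx => by have := h hx; rwa [Real.dist_eq] at this⟩
  set R' := min R δ with hR'def
  have hR' : 0 < R' := lt_min hR hδ
  have hg' : ∀ x ∈ ball p R', x ≠ p → HarmonicAt g x := fun x hx hxp =>
    hg x (ball_subset_ball (min_le_left _ _) hx) hxp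
  have hM' : ∀ x ∈ ball p R', x ≠ p → |g x| ≤ |g p| + 1 := fun x hx _ => by
    have h1 := hδb x (ball_subset_ball (min_le_right _ _) hx)
    have h2 := abs_sub_abs_le_abs_sub (g x) (g p)
    linarith
  obtain ⟨G, hG, hGg⟩ := exists_harmonicOnNhd_eq_of_bounded hn hR' hg' hM'
  have hp := hG p (mem_ball_self hR')
  -- `G p = g p` by continuity at `p`
  have hcg : G p = g p := by
    haveI : Nontrivial E := Module.nontrivial_of_finrank_pos (R := ℝ) (by omega)
    haveI : (𝓝[≠] p).NeBot := Module.punctured_nhds_neBot ℝ E p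
    have h1 : Tendsto G (𝓝[≠] p) (𝓝 (G p)) :=
      hp.1.continuousAt.tendsto.mono_left nhdsWithin_le_nhds
    have h2 : Tendsto g (𝓝[≠] p) (𝓝 (g p)) := hc.tendsto.mono_left nhdsWithin_le_nhds
    have h3 : Tendsto g (𝓝[≠] p) (𝓝 (G p)) :=
      h1.congr' (eventually_nhdsWithin_of_forall fun x hx => hGg x hx)
    exact tendsto_nhds_unique h3 h2
  have hfun : G = g := by
    funext x
    by_cases hx : x = p
    · rw [hx, hcg]
    · exact hGg x hx
  rw [hfun] at hp
  exact hp

/-- **Finitely many bounded isolated singularities are removable (`n ≥ 3`).** If `U` is harmonic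
off a finite set `T` and bounded on a punctured neighbourhood of each point of `T`, then `U`
agrees off `T` with a function `V` harmonic on the whole space (apply
`exists_harmonicOnNhd_eq_of_bounded` at the points of `T` one at a time). [folklore] -/
theorem exists_harmonicOnNhd_univ_eq_of_finset [FiniteDimensional ℝ E] [MeasurableSpace E]
    [BorelSpace E] (hn : 3 ≤ finrank ℝ E) (T : Finset E) {U : E → ℝ}
    (hU : ∀ x ∉ T, HarmonicAt U x)
    (hb : ∀ p ∈ T, ∃ r > 0, ∃ M : ℝ, ∀ x ∈ ball p r, x ∉ T → |U x| ≤ M) :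
    ∃ V : E → ℝ, HarmonicOnNhd V univ ∧ ∀ x ∉ T, V x = U x := by
  classical
  induction T using Finset.induction_on generalizing U with
  | empty => exact ⟨U, fun x _ => hU x (by simp), fun x _ => rfl⟩
  | @insert p T hpT ih =>
    -- a punctured ball at `p` avoiding `T`, with the bound
    obtain ⟨r, hr, M, hM⟩ := hb p (Finset.mem_insert_self p T)
    have hTc : ((T : Set E))ᶜ ∈ 𝓝 p :=
      T.finite_toSet.isClosed.isOpen_compl.mem_nhds (by simpa using hpT)
    obtain ⟨r', hr', hball⟩ := Metric.mem_nhds_iff.1 hTc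
    set s := min r r' with hs
    have hs0 : 0 < s := lt_min hr hr'
    have hnotin : ∀ x ∈ ball p s, x ≠ p → x ∉ insert p T := fun x hx hxp => by
      rw [Finset.mem_insert, not_or]
      refine ⟨hxp, fun hxT => hball (ball_subset_ball (min_le_right _ _) hx) ?_⟩
      simpa using hxT
    obtain ⟨G, hG, hGU⟩ := exists_harmonicOnNhd_eq_of_bounded hn hs0
      (fun x hx hxp => hU x (hnotin x hx hxp))
      (fun x hx hxp => hM x (ball_subset_ball (min_le_left _ _) hx) (hnotin x hx hxp))
    -- extend across `p`
    set U' : E → ℝ := fun x => if x = p then G p else U x with hU'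
    have hU'G : ∀ x ∈ ball p s, U' x = G x := fun x hx => by
      by_cases hxp : x = p
      · simp [hU', hxp]
      · simp [hU', hxp, hGU x hxp]
    have hU'U : ∀ x, x ≠ p → U' x = U x := fun x hxp => by simp [hU', hxp]
    have hU'h : ∀ x ∉ T, HarmonicAt U' x := by
      intro x hxT
      by_cases hxb : x ∈ ball p s
      · have hev : U' =ᶠ[𝓝 x] G := Filter.eventually_of_mem (isOpen_ball.mem_nhds hxb) hU'G
        exact (harmonicAt_congr_nhds hev).2 (hG x hxb)
      · have hxp : x ≠ p := fun h => hxb (h ▸ mem_ball_self hs0)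
        have hev : U' =ᶠ[𝓝 x] U :=
          Filter.eventually_of_mem (compl_singleton_mem_nhds hxp) fun w hw => hU'U w hw
        have hx' : x ∉ insert p T := by simp [hxp, hxT]
        exact (harmonicAt_congr_nhds hev).2 (hU x hx')
    have hb' : ∀ q ∈ T, ∃ r > 0, ∃ M : ℝ, ∀ x ∈ ball q r, x ∉ T → |U' x| ≤ M := by
      intro q hq
      obtain ⟨rq, hrq, Mq, hMq⟩ := hb q (Finset.mem_insert_of_mem hq)
      refine ⟨rq, hrq, max Mq |G p|, fun x hx hxT => ?_⟩
      by_cases hxp : x = p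
      · subst hxp
        have : U' x = G x := by simp [hU']
        rw [this]
        exact le_max_right _ _
      · rw [hU'U x hxp]
        exact (hMq x hx (by simp [hxp, hxT])).trans (le_max_left _ _)
    obtain ⟨V, hV, hVU'⟩ := ih hU'h hb'
    refine ⟨V, hV, fun x hx => ?_⟩
    rw [Finset.mem_insert, not_or] at hx
    rw [hVU' x hx.2, hU'U x hx.1]

end Literature.Analysis.FluidPDE
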